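import Mathlib
import Summits.NavierStokesRegularity.NavierStokesRegularity.Theorems.EulerZoomLiouvillePowerGaugeEulerLiouvilleKelvinPhysicalFarField
import Summits.NavierStokesRegularity.NavierStokesRegularity.Theorems.EulerZoomLiouvillePowerGaugeEulerLiouvilleSelfSimilarKelvinCompactVorticity
import HarnessLib.Audit

/-!
# Crux `EulerZoomLiouville.PowerGaugeEulerLiouville`: COMPACT VORTICITY SUPPORT OF CLASSICAL
# ENERGY-CONCENTRATING MEMBERS, from Kelvin's theorem in physical variables

Route №10 `EulerZoomLiouville` (NavierStokesRegularity), crux E = stmt-NavierStokesRegularity-19832,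
registered residues `stub_nonSelfSimilar` (⊇ DSS) and the endpoint of `stub_selfSimilarExtremal`.
Sequel to `…KelvinPhysicalFarField` (the far-field Kelvin bound under (a) `‖u‖ ≤ M(−τ)^{γ−1}`,
(b) `‖∇u‖ ≤ ε/(−τ)` for `|x| ≥ R(−τ)^γ`, (c) `∫_{|x|≥r}|u(τ)|² ≤ C r^{−β}(−τ)^{γβ}`):

* `integral_inner_eq_zero` — if `ε < γβ/2`, `∫ ⟪u(t₀), B⟫ = 0` for every compactly supported
  divergence-free `B` supported in `{|a| ≥ L}`, `L ≥ (max R R₀ + M/γ)(−t₀)^γ`, `L > (M/γ)(−t₀)^γ`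
  (substitute `t = −e^{−σ}` in the far-field bound and let `σ → ∞`);
* `curl_eq_zero_of_far` — **`curl u(t₀)` vanishes outside the ball of radius
  `(max R R₀ + |M|/γ + 1)(−t₀)^γ`**, at every time `t₀ < 0` (test with `B = curl(g eᵢ)`,
  `∫ ⟪u, curl A⟫ = ∫ ⟪curl u, A⟫`, fundamental lemma on the open far region).

The sequel `…ClassicalConcentrating` is the member-level stratum: with the support radius
shrinking like `(−t)^γ` and the support volume conserved, the flow is irrotational, hence trivial.

WHAT THIS IS NOT: not NS, not E — CLASSICAL members under the explicit hypotheses (a)–(c).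

## References

* A. J. Majda, A. L. Bertozzi, *Vorticity and Incompressible Flow*, CUP 2002, §1.6 Prop. 1.11.
  [MajdaBertozziCUP2002]
* D. Chae, J. Wolf, Comm. Math. Phys. 376 (2020) = arXiv:1706.02020, §3.4. [ChaeWolf2020EulerTypeI]
-/

noncomputable section

-- flat `Theorems/<Route><Decl>…` files of one crux share the namespace of the crux (tree convention)
set_option linter.dupNamespace false

open MeasureTheory Set Filter Topology Metric Function InnerProductSpace
open scoped RealInnerProductSpace NNReal ENNReal ContDiff

namespace Summit.NavierStokesRegularity.NavierStokesRegularity.Theorems.PowerGaugeEulerLiouville.KelvinPhysical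

open Literature.Analysis Literature.Analysis.FunctionSpaces Literature.Analysis.FluidPDE

variable {u : ℝ → EuclideanSpace ℝ (Fin 3) → EuclideanSpace ℝ (Fin 3)}
  {p : ℝ → EuclideanSpace ℝ (Fin 3) → ℝ} {γ : ℝ}

/-- **Far-field vorticity is invisible to the energy, in physical variables**: under (a)–(c) with
`ε < γβ/2`, `∫ ⟪u(t₀), B⟫ = 0` for every compactly supported divergence-free `B` supported in
`{|a| ≥ L}`, `L ≥ (max R R₀ + M/γ)(−t₀)^γ`, `L > (M/γ)(−t₀)^γ` (let `t → 0⁻` in the far-field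
Kelvin bound: with `t = −e^{−σ}` the right side is `A e^{−(γβ/2 − ε)σ} → 0`).
[cite: MajdaBertozziCUP2002, §1.6 Prop. 1.11; ChaeWolf2020EulerTypeI, §3.4] -/
theorem integral_inner_eq_zero (h : IsClassicalEulerSolutionOn (Iio 0) 0 u p)
    (hL : ODE.IsUniformlyLipschitzOn u (Iio 0)) (hγ : 0 < γ) {M : ℝ}
    (hM : ∀ τ : ℝ, τ < 0 → ∀ x, ‖u τ x‖ ≤ M * (-τ) ^ (γ - 1)) {ε R : ℝ} (hR : 0 ≤ R)
    (hfar : ∀ τ : ℝ, τ < 0 → ∀ x : EuclideanSpace ℝ (Fin 3), R * (-τ) ^ γ ≤ ‖x‖ →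
      ‖fderiv ℝ (u τ) x‖ ≤ ε / (-τ))
    {β C R₀ : ℝ} (hR₀ : 0 ≤ R₀)
    (htail : ∀ τ : ℝ, τ < 0 → ∀ r : ℝ, R₀ * (-τ) ^ γ ≤ r →
      ∫ x in {x | r ≤ ‖x‖}, ‖u τ x‖ ^ 2 ≤ C * r ^ (-β) * (-τ) ^ (γ * β))
    (hu2 : ∀ τ : ℝ, τ < 0 → Integrable (fun x => ‖u τ x‖ ^ 2) volume)
    (hrate : ε < γ * β / 2)
    {t₀ : ℝ} (ht₀ : t₀ < 0) {L : ℝ} (hLR : (R + M / γ) * (-t₀) ^ γ ≤ L)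
    (hLR₀ : (R₀ + M / γ) * (-t₀) ^ γ ≤ L) (hL0 : M / γ * (-t₀) ^ γ < L)
    {B : EuclideanSpace ℝ (Fin 3) → EuclideanSpace ℝ (Fin 3)} (hB : ContDiff ℝ ∞ B)
    (hBc : HasCompactSupport B) (hBdiv : VectorCalculus.IsDivFree B)
    (hBL : ∀ a ∈ tsupport B, L ≤ ‖a‖) :
    ∫ a, ⟪u t₀ a, B a⟫ = 0 := by
  obtain ⟨Bmax, hBmax⟩ := hB.continuous.bounded_above_of_compact_support hBc
  set A₀ : ℝ := Bmax * ((C * (L - M / γ * (-t₀) ^ γ) ^ (-β) + (volume (tsupport B)).toReal) / 2)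
    with hA₀
  set κ : ℝ := ε - γ * β / 2 with hκ
  have hκ0 : κ < 0 := by rw [hκ]; linarith
  -- the bound along `t = −e^{−σ}`, `σ ≥ σ₀ = −log(−t₀)`
  have hbound : ∀ σ : ℝ, -Real.log (-t₀) ≤ σ →
      |∫ a, ⟪u t₀ a, B a⟫| ≤ A₀ * Real.exp (ε * Real.log (-t₀)) * Real.exp (κ * σ) := by
    intro σ hσ
    set t : ℝ := -Real.exp (-σ) with ht
    have htneg : t < 0 := by rw [ht]; exact neg_neg_of_pos (Real.exp_pos _)
    have hlogt : Real.log (-t) = -σ := by rw [ht, neg_neg, Real.log_exp]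
    have ht₀t : t₀ ≤ t := by
      rw [ht]
      have h1 : Real.exp (-σ) ≤ Real.exp (Real.log (-t₀)) := Real.exp_le_exp.2 (by linarith)
      rw [Real.exp_log (by linarith)] at h1
      linarith
    have key := abs_integral_inner_le_exp h hL hγ hM hR hfar hR₀ htail hu2 hLR hLR₀ hL0 hB hBc
      hBdiv hBL hBmax ht₀t htneg
    rw [hlogt] at key
    refine key.trans (le_of_eq ?_)
    rw [hA₀, hκ]
    have e1 : Real.exp (ε * (Real.log (-t₀) - -σ)) = Real.exp (ε * Real.log (-t₀)) * Real.exp (ε * σ) := by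
      rw [← Real.exp_add]; ring_nf
    have e2 : Real.exp ((ε - γ * β / 2) * σ) = Real.exp (ε * σ) * Real.exp (γ * β / 2 * -σ) := by
      rw [← Real.exp_add]; ring_nf
    rw [e1, e2]; ring
  by_contra hne
  have hpos : 0 < |∫ a, ⟪u t₀ a, B a⟫| := abs_pos.2 hne
  have htend : Tendsto (fun σ : ℝ => A₀ * Real.exp (ε * Real.log (-t₀)) * Real.exp (κ * σ)) atTop
      (𝓝 0) := by
    have h1 : Tendsto (fun σ : ℝ => Real.exp (κ * σ)) atTop (𝓝 0) :=
      Real.tendsto_exp_atBot.comp (tendsto_id.const_mul_atTop_of_neg hκ0)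
    simpa using h1.const_mul (A₀ * Real.exp (ε * Real.log (-t₀)))
  obtain ⟨σ, hσ1, hσ2⟩ :=
    ((htend.eventually (gt_mem_nhds hpos)).and (eventually_ge_atTop (-Real.log (-t₀)))).exists
  exact (lt_irrefl _ ((hbound σ hσ2).trans_lt hσ1))

/-- **At every time the vorticity of a classical energy-concentrating member has compact
support**, of radius `(max R R₀ + M/γ + 1)(−t₀)^γ`: hypotheses (a), far-field gradient smallness
in the `∀ ε ∃ R` form, (c) with some `β > 0`, `∫|u(τ)|² < ∞`.  (Test the previous identity with
`B = curl(g eᵢ)`, `∫ ⟪u, curl A⟫ = ∫ ⟪curl u, A⟫`, fundamental lemma on the open far region.)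
[cite: MajdaBertozziCUP2002, §1.6 Prop. 1.11; ChaeWolf2020EulerTypeI, §3.4] -/
theorem curl_eq_zero_of_far (h : IsClassicalEulerSolutionOn (Iio 0) 0 u p)
    (hL : ODE.IsUniformlyLipschitzOn u (Iio 0)) (hγ : 0 < γ) {M : ℝ}
    (hM : ∀ τ : ℝ, τ < 0 → ∀ x, ‖u τ x‖ ≤ M * (-τ) ^ (γ - 1)) {ε R : ℝ} (hR : 0 ≤ R)
    (hfar : ∀ τ : ℝ, τ < 0 → ∀ x : EuclideanSpace ℝ (Fin 3), R * (-τ) ^ γ ≤ ‖x‖ →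
      ‖fderiv ℝ (u τ) x‖ ≤ ε / (-τ))
    {β C R₀ : ℝ} (hR₀ : 0 ≤ R₀)
    (htail : ∀ τ : ℝ, τ < 0 → ∀ r : ℝ, R₀ * (-τ) ^ γ ≤ r →
      ∫ x in {x | r ≤ ‖x‖}, ‖u τ x‖ ^ 2 ≤ C * r ^ (-β) * (-τ) ^ (γ * β))
    (hu2 : ∀ τ : ℝ, τ < 0 → Integrable (fun x => ‖u τ x‖ ^ 2) volume)
    (hrate : ε < γ * β / 2) {t₀ : ℝ} (ht₀ : t₀ < 0) {x : EuclideanSpace ℝ (Fin 3)}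
    (hx : (max R R₀ + |M| / γ + 1) * (-t₀) ^ γ < ‖x‖) : curl (u t₀) x = 0 := by
  set L : ℝ := (max R R₀ + |M| / γ + 1) * (-t₀) ^ γ with hLdef
  have htγ : 0 < (-t₀) ^ γ := Real.rpow_pos_of_pos (by linarith) _
  have hMabs : M / γ ≤ |M| / γ := div_le_div_of_nonneg_right (le_abs_self M) hγ.le
  have hLR : (R + M / γ) * (-t₀) ^ γ ≤ L := by
    rw [hLdef]; exact mul_le_mul_of_nonneg_right (by linarith [le_max_left R R₀]) htγ.le
  have hLR₀ : (R₀ + M / γ) * (-t₀) ^ γ ≤ L := by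
    rw [hLdef]; exact mul_le_mul_of_nonneg_right (by linarith [le_max_right R R₀]) htγ.le
  have hL0 : M / γ * (-t₀) ^ γ < L := by
    rw [hLdef]
    exact mul_lt_mul_of_pos_right (by linarith [le_max_left R R₀]) htγ
  have key : ∀ B : EuclideanSpace ℝ (Fin 3) → EuclideanSpace ℝ (Fin 3), ContDiff ℝ ∞ B →
      HasCompactSupport B → VectorCalculus.IsDivFree B → (∀ a ∈ tsupport B, L ≤ ‖a‖) →
      ∫ a, ⟪u t₀ a, B a⟫ = 0 := fun B hB hBc hBdiv hBL =>
    integral_inner_eq_zero h hL hγ hM hR hfar hR₀ htail hu2 hrate ht₀ hLR hLR₀ hL0 hB hBc hBdiv hBL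
  -- the open far region
  set U : Set (EuclideanSpace ℝ (Fin 3)) := {y | L < ‖y‖} with hU
  have hUo : IsOpen U := isOpen_lt continuous_const continuous_norm
  have hu1 : ContDiff ℝ 1 (u t₀) := (h.contDiff_velocity ht₀).of_le (mod_cast le_top)
  have hcurlc : Continuous (curl (u t₀)) := (contDiff_curl (n := 0) (by simpa using hu1)).continuous
  have hcomp : ∀ i : Fin 3, ∀ y ∈ U, (curl (u t₀) y) i = 0 := by
    intro i y hy
    have hci : Continuous fun x => (curl (u t₀) x) i := (PiLp.continuous_apply 2 _ i).comp hcurlc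
    refine Kelvin.eq_zero_of_ae_of_isOpen hci hUo ?_ hy
    refine hUo.ae_eq_zero_of_integral_contDiff_smul_eq_zero
      (hci.locallyIntegrable.locallyIntegrableOn U) fun g hg hgc hgU => ?_
    set A : EuclideanSpace ℝ (Fin 3) → EuclideanSpace ℝ (Fin 3) :=
      fun x => g x • EuclideanSpace.single i (1 : ℝ) with hA
    have hAs : ContDiff ℝ ∞ A := hg.smul contDiff_const
    have hAc : HasCompactSupport A := hgc.smul_right
    have hBs : ContDiff ℝ ∞ (curl A) := contDiff_curl (n := ⊤) (by simpa using hAs)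
    have hBc : HasCompactSupport (curl A) := hasCompactSupport_curl hAc
    have hBdiv : VectorCalculus.IsDivFree (curl A) := fun x =>
      divergence_curl_eq_zero_holds A (hAs.of_le (by norm_cast)) x
    have hBL : ∀ y ∈ tsupport (curl A), L ≤ ‖y‖ := by
      intro y hy
      have h1 : tsupport (curl A) ⊆ tsupport A :=
        closure_minimal (fun x hx => by
          by_contra hxA
          exact hx (curl_eq_zero_of_notMem_tsupport hxA)) (isClosed_tsupport A)
      have h2 : tsupport A ⊆ tsupport g := tsupport_smul_subset_left _ _
      exact le_of_lt (hgU (h2 (h1 hy)))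
    have h0 := key (curl A) hBs hBc hBdiv hBL
    rw [← integral_inner_curl_eq_integral_inner_curl hu1 (hAs.of_le (mod_cast le_top)) hAc] at h0
    rw [← h0]
    refine integral_congr_ae (Eventually.of_forall fun x => ?_)
    simp only [hA, inner_smul_right, EuclideanSpace.inner_single_right, one_mul, conj_trivial,
      smul_eq_mul]
  exact PiLp.ext fun i => by simpa using hcomp i x hx


end Summit.NavierStokesRegularity.NavierStokesRegularity.Theorems.PowerGaugeEulerLiouville.KelvinPhysical

end
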